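import Summits.NavierStokesRegularity.FunctionalMining.TopEigStrainMixDeriv
import HarnessLib

/-!
# FunctionalMining — K1-Q6 (a) HOLDS: the mixtures `F_ε = Φ_q + ε Z_q` obey the saturating law
# `T_LD` for EVERY `ε > 0` (real `q > 2`), with the rate exponent `γ + 1 + 1/σ`

Search for candidate a priori estimates; no regularity claim. Cell `pub-nsfunc`, prove seat
(gen 24). The dictionary's candidate law `TopEigStrainMixLaw q ε` (`SpectralMixtureCandidates`, dict
seat: escape (a) of the no-go door D-K6, booked OPEN for every `ε > 0`) is PROVED here for every real
`q > 2` and every `ε > 0`, together with the upper bound `γ + 1 + 1/σ = (5q−5)/(2q−3)` on its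
dictionary number (`TopEigStrainMixRate q (γ + 1 + 1/σ)`, `σ = 2q − 3`, `γ = (3q−3)/(2q−3)`): an a
priori inequality along every zero-mean classical solution of unforced Navier–Stokes on `T³`,
small-data closing only. The derivative step is `TopEigStrainMixDeriv` (right derivative of
`F_ε(u(s))` at every `t ∈ [a, b)` with the budget `κ(ε) ν^{−γ} (2ℰ) F_ε^{1+1/σ}`,
`κ(ε) = (q/2) C₀ (1+ε)^{1/(1−a)} ε^{−(γ+1+1/σ)}`); here:

* **`TopEig.exists_topEigStrainMix_rate_le`** — every one-sided derivative value of `s ↦ F_ε(u(s))`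
  within the window is `≤ κ(ε) ν^{−γ} (2ℰ) F_ε^{1+1/σ}` (fence from the right derivatives and the
  continuity of `F_ε(u(s))`, then Dini fencing with the continuous budget);
* **`TopEig.topEigStrainMixLaw_of_two_lt`** — `2 < q → 0 < ε → TopEigStrainMixLaw q ε` on `T³`;
* **`TopEig.topEigStrainMixRate_of_two_lt`** — `2 < q → TopEigStrainMixRate q ((3q−3)/(2q−3) + (1 +
  (2q−3)⁻¹))` (for `ε ≤ 1`, `(1+ε)^{1/(1−a)} ≤ 2^{1/(1−a)}`).

`κ(ε) → ∞` as `ε ↓ 0`, consistently with the no-go seat's kill of `Φ_q` alone (level `ε = 0`, pen)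
and with `SaturatingLawSup.of_add_smul_tendsto_zero` ("necessarily `κ(ε) → ∞`"); with census-2's
`TopEigStrainMixRate.pos_of_family` (the exponent is `> 0` given the kill family) the dictionary
number is bracketed `0 < a* ≤ (5q−5)/(2q−3)`, the lower end conditional on the pen family. Rows
`q = 2` and `3/2 < q < 2` are NOT covered (the tree's strain-moment chain is for real `q > 2`).
Nothing here is about Navier–Stokes regularity. [ours]
-/

noncomputable section

open MeasureTheory Set Filter Topology Finset

namespace Summit.NavierStokesRegularity.FunctionalMining

open Literature.Analysis.FunctionSpaces Literature.Analysis.FluidPDE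

namespace TopEig

open StrainL4 StrainMoment VorticityL4 StrainTensor Torus

variable {q : ℝ}

/-! ## 4. The fence, the derivative values, and the law -/

/-- **K1-Q6 (a) in derivative-value form, one constant for all `ε`.** For real `q > 2` there is
`C₀ ≥ 0` such that for every `ε > 0`, along every classical solution of unforced Navier–Stokes on `T³`
(`ν > 0`), every one-sided derivative value `R` of `s ↦ F_ε(u(s))` within the window satisfies
`R ≤ κ(ε) ν^{−γ} (2ℰ) F_ε^{1+1/σ}`, `κ(ε) = (q/2) C₀ (1+ε)^{1/(1−a)} ε^{−(γ+1+1/σ)}`. [ours] -/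
theorem exists_topEigStrainMix_rate_le (hq : 2 < q) :
    ∃ C₀ : ℝ, 0 ≤ C₀ ∧ ∀ {ε : ℝ}, 0 < ε → ∀ {ν a b : ℝ}, 0 < ν → a < b →
      ∀ {u : ℝ → UnitAddTorus (Fin 3) → EuclideanSpace ℝ (Fin 3)} {p : ℝ → UnitAddTorus (Fin 3) → ℝ},
      Torus.IsClassicalNSSolutionOn (Icc a b) ν 0 u p →
      ∀ t ∈ Icc a b, ∀ R : ℝ, HasDerivWithinAt (fun s => topEigStrainMix q ε (u s)) R (Icc a b) t →
        R ≤ q / 2 * C₀ * (1 + ε) ^ (1 / (1 - (3 * q - 3) / (5 * q - 6))) *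
          ε ^ (-((3 * q - 3) / (2 * q - 3) + (1 + (2 * q - 3)⁻¹))) * ν ^ (-((3 * q - 3) / (2 * q - 3))) *
          ((2 * torusEnstrophy (u t)) * topEigStrainMix q ε (u t) ^ (1 + (2 * q - 3)⁻¹)) := by
  obtain ⟨C₀, hC₀, hder⟩ := exists_topEigStrainMix_rightDeriv_le hq
  refine ⟨C₀, hC₀, ?_⟩
  intro ε hε ν a b hν hab u p hsol t ht R hR
  have h23 : 0 < 2 * q - 3 := by linarith
  have hpw : 0 ≤ 1 + (2 * q - 3)⁻¹ := by have := inv_pos.2 h23; linarith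
  set κ : ℝ := q / 2 * C₀ * (1 + ε) ^ (1 / (1 - (3 * q - 3) / (5 * q - 6))) *
    ε ^ (-((3 * q - 3) / (2 * q - 3) + (1 + (2 * q - 3)⁻¹))) * ν ^ (-((3 * q - 3) / (2 * q - 3))) with hκ
  set bud : ℝ → ℝ := fun s => κ * ((2 * torusEnstrophy (u s)) *
    topEigStrainMix q ε (u s) ^ (1 + (2 * q - 3)⁻¹)) with hbud
  show R ≤ bud t
  -- continuity of the budget within the window
  have hcont : ContinuousWithinAt bud (Icc a b) t := by
    have hE : ContinuousWithinAt (fun s => torusEnstrophy (u s)) (Icc a b) t :=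
      (hsol.hasDerivWithinAt_half_gradNormSq hab ht).continuousWithinAt
    have hF := continuousWithinAt_topEigStrainMix hq ε hν.le hab hsol ht
    exact continuousWithinAt_const.mul ((continuousWithinAt_const.mul hE).mul
      (hF.rpow_const (Or.inr hpw)))
  -- the fence
  have hfence : ∀ ⦃t₁ t₂ : ℝ⦄, t₁ ∈ Icc a b → t₂ ∈ Icc a b → t₁ ≤ t₂ → ∀ ⦃K : ℝ⦄,
      (∀ σ ∈ Icc t₁ t₂, bud σ ≤ K) →
      topEigStrainMix q ε (u t₂) - topEigStrainMix q ε (u t₁) ≤ K * (t₂ - t₁) := by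
    intro t₁ t₂ ht₁ ht₂ h12 K hK
    have hcontF : ContinuousOn (fun s => topEigStrainMix q ε (u s)) (Icc t₁ t₂) := fun s hs =>
      (continuousWithinAt_topEigStrainMix hq ε hν.le hab hsol ⟨ht₁.1.trans hs.1, hs.2.trans ht₂.2⟩).mono
        (Icc_subset_Icc ht₁.1 ht₂.2)
    -- right derivatives on `[t₁, t₂)` and their bound
    have hD : ∀ x ∈ Ico t₁ t₂, ∃ R' : ℝ,
        HasDerivWithinAt (fun s => topEigStrainMix q ε (u s)) R' (Ici x) x ∧ R' ≤ K := by
      intro x hx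
      have hxab : x ∈ Ico a b := ⟨ht₁.1.trans hx.1, lt_of_lt_of_le hx.2 ht₂.2⟩
      obtain ⟨R', hR', hle⟩ := hder hε hν hab hsol hxab
      exact ⟨R', hR', hle.trans (le_of_eq_of_le rfl (hK x ⟨hx.1, hx.2.le⟩))⟩
    choose! f' hf' hf'le using hD
    exact sub_le_mul_of_deriv_right_le h12 hcontF (fun x hx => hf' x hx) (fun x hx => hf'le x hx)
  exact hasDerivWithinAt_le_of_fence hab ht hcont hfence hR

/-- **K1-Q6 (a) HOLDS for every `ε > 0` (real `q > 2`): `TopEigStrainMixLaw q ε` on `T³`** — the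
mixture `F_ε = ∫(λ₁⁺)^q(S) + ε ∫|S|^q` obeys the saturating law `T_LD` (one-sided-derivative-value
form) with exponents `σ = 2q−3`, `γ = (3q−3)/(2q−3)` and SOME constant `κ(ε)`. An a priori
inequality along zero-mean classical solutions of unforced Navier–Stokes on `T³`; small-data closing
only; search for candidate a priori estimates; no regularity claim. [ours] -/
theorem topEigStrainMixLaw_of_two_lt (hq : 2 < q) {ε : ℝ} (hε : 0 < ε) :
    TopEigStrainMixLaw (d := Fin 3) q ε := by
  obtain ⟨C₀, hC₀, h⟩ := exists_topEigStrainMix_rate_le hq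
  refine ⟨q / 2 * C₀ * (1 + ε) ^ (1 / (1 - (3 * q - 3) / (5 * q - 6))) *
    ε ^ (-((3 * q - 3) / (2 * q - 3) + (1 + (2 * q - 3)⁻¹))), ?_, ?_⟩
  · have hq0 : 0 ≤ q / 2 := by linarith
    exact mul_nonneg (mul_nonneg (mul_nonneg hq0 hC₀) (Real.rpow_nonneg (by linarith) _))
      (Real.rpow_nonneg hε.le _)
  · intro _ ν hν a b hab u p hsol _ t ht R hR
    have h1 := h hε hν hab hsol t ht R hR
    calc R ≤ _ := h1
      _ = _ := by ring

/-- **The dictionary number of K1-Q6 (a) is at most `γ + 1 + 1/σ`:** for real `q > 2`,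
`TopEigStrainMixRate q ((3q−3)/(2q−3) + (1 + (2q−3)⁻¹))` on `T³` — for all `ε ∈ (0, 1]` the law for
`F_ε` holds with constant `C ε^{−(γ+1+1/σ)}`, `C = (q/2) C₀ 2^{1/(1−a)}`. [ours] -/
theorem topEigStrainMixRate_of_two_lt (hq : 2 < q) :
    TopEigStrainMixRate (d := Fin 3) q ((3 * q - 3) / (2 * q - 3) + (1 + (2 * q - 3)⁻¹)) := by
  obtain ⟨C₀, hC₀, h⟩ := exists_topEigStrainMix_rate_le hq
  have h56 : 0 < 5 * q - 6 := by linarith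
  have h1e : 0 < 1 - (3 * q - 3) / (5 * q - 6) := by
    rw [sub_pos, div_lt_one h56]; linarith
  refine ⟨q / 2 * C₀ * (2 : ℝ) ^ (1 / (1 - (3 * q - 3) / (5 * q - 6))), 1, one_pos, ?_⟩
  intro ε hε hε1 _ ν hν a b hab u p hsol _ t ht R hR
  have h1 := h hε hν hab hsol t ht R hR
  have hq0 : 0 ≤ q / 2 := by linarith
  have hpow : (1 + ε) ^ (1 / (1 - (3 * q - 3) / (5 * q - 6))) ≤
      (2 : ℝ) ^ (1 / (1 - (3 * q - 3) / (5 * q - 6))) :=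
    Real.rpow_le_rpow (by linarith) (by linarith) (le_of_lt (div_pos one_pos h1e))
  have hx : 0 ≤ ε ^ (-((3 * q - 3) / (2 * q - 3) + (1 + (2 * q - 3)⁻¹))) * ν ^ (-((3 * q - 3) / (2 * q - 3))) *
      ((2 * torusEnstrophy (u t)) * topEigStrainMix q ε (u t) ^ (1 + (2 * q - 3)⁻¹)) :=
    mul_nonneg (mul_nonneg (Real.rpow_nonneg hε.le _) (Real.rpow_nonneg hν.le _))
      (mul_nonneg (mul_nonneg (by norm_num) (torusEnstrophy_nonneg _))
        (Real.rpow_nonneg (topEigStrainMix_nonneg hε.le _) _))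
  calc R ≤ q / 2 * C₀ * (1 + ε) ^ (1 / (1 - (3 * q - 3) / (5 * q - 6))) *
        (ε ^ (-((3 * q - 3) / (2 * q - 3) + (1 + (2 * q - 3)⁻¹))) * ν ^ (-((3 * q - 3) / (2 * q - 3))) *
        ((2 * torusEnstrophy (u t)) * topEigStrainMix q ε (u t) ^ (1 + (2 * q - 3)⁻¹))) := by
        calc R ≤ _ := h1
          _ = _ := by ring
    _ ≤ q / 2 * C₀ * (2 : ℝ) ^ (1 / (1 - (3 * q - 3) / (5 * q - 6))) *
        (ε ^ (-((3 * q - 3) / (2 * q - 3) + (1 + (2 * q - 3)⁻¹))) * ν ^ (-((3 * q - 3) / (2 * q - 3))) *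
        ((2 * torusEnstrophy (u t)) * topEigStrainMix q ε (u t) ^ (1 + (2 * q - 3)⁻¹))) :=
        mul_le_mul_of_nonneg_right (mul_le_mul_of_nonneg_left hpow (mul_nonneg hq0 hC₀)) hx
    _ = _ := by ring

end TopEig

end Summit.NavierStokesRegularity.FunctionalMining

end
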